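import Summits.QuantumFields.YangMills.Theorems.EntropyBudgetEquipartitionTwoSidedDlrEventually
import Summits.QuantumFields.YangMills.Theorems.WeakCouplingRatesBulkDominatesColdBoxWDirKernelTwoPoint
import HarnessLib

/-!
# Route `EntropyBudgetEquipartition`, crux `EntropyBudgetTransfer` (stmt-QuantumFields-22401) — helper:
# the two-sided law at separation `⌈β^A⌉` with the FREE-GLUON constant `σ·C(⌈β^A⌉)²` (Dirichlet kernel → `ℤ⁴` kernel)

HONEST LABEL: plumbing toward a RECORD-label rung (R2ξ-G, the all-`G` leaf `WeakCouplingRates.XiPow`, an UPPER bound on the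
lattice gap); nothing here bears on the Yang–Mills mass gap.  The one-scale statements are HYPOTHESES.

`twoSidedLaw_eventually_of_kernel_bounds` (`…TwoSidedDlrEventually`) concludes `|β²·torusPlaqCov ρ β L ⌈β^A⌉ 1 2 − Φ(β)| ≤ β^{−κ'}`
for an abstract kernel-side constant `Φ(β)`.  The one-scale expansions of the sibling line produce
`Φ(β) = σ·C_D(p_c, p_c + ⌈β^A⌉e₀)²` with `C_D = boxDirProjKernel ⌈β^θ⌉` the temporal-gauge DIRICHLET kernel of the cold box and
`σ = dim G/2`; the crux speaks of the `ℤ⁴` lattice-Maxwell number `C(n) = curvaturePlaquetteCorr 4 n`.  The tree's potential theory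
closes the gap: `C_D(p_c, p_c+Te₀) = boxDirichletPlaqCov H T` (`boxDirProjKernel_centre_eq`), `|boxDirichletPlaqCov H T − C(T)| ≤ K/H⁴`
for `H ≥ 32`, `T ≤ H/8` (`exists_boxDirichletPlaqCov_sub_bound`), and `0 ≤ C_D ≤ 1` eventually (`dirKernelTwoPoint`, `0 < A < θ`).

* `twoSidedLaw_eventually_freeGluon` — same hypotheses as `twoSidedLaw_eventually_of_kernel_bounds` but with the kernel-side
  constant FIXED to `σ·C_D²` (`0 ≤ σ`; no a-priori bound on it is asked) and `0 < A < θ`; conclusion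
  `∃ κ'' > 0, ∃ β₀, ∀ β ≥ β₀, ∀ᶠ L, |β²·torusPlaqCov ρ β L ⌈β^A⌉ 1 2 − σ·C(⌈β^A⌉)²| ≤ β^{−κ''}` — literally the summand of the crux
  `EntropyBudgetTransfer` at the separation `n = ⌈β^A⌉` (`torusPlaqCov` is its covariance by definition), for every compact `G`.

Written by width seat 2/3 (gen 3) of line `ym-line-ebe-p1` as `--supports stmt-QuantumFields-22401`.
References: H.-O. Georgii (2011) Thm. 4.17; G. Lawler, V. Limic, *Random Walk: A Modern Introduction* (2010) §4.3–4.4, §6.3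
(Dirichlet vs free Green kernels). [folklore]
-/

set_option autoImplicit false

noncomputable section

open MeasureTheory Filter Topology
open Literature.MathematicalPhysics
open Literature.MathematicalPhysics.QuantumFieldTheory
open Literature.MathematicalPhysics.QuantumLattice
open Summit.QuantumFields.YangMills.Theorems.WeakCouplingRates
open Summit.QuantumFields.YangMills.Theorems.ColdBoxAllGroups

namespace Summit.QuantumFields.YangMills.Theorems.EntropyBudgetEquipartition.TwoSidedDlr

variable {N : ℕ} {G : Type*} [Group G] [TopologicalSpace G] [IsTopologicalGroup G] [CompactSpace G]
  [MeasurableSpace G] [BorelSpace G]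

/-- **The Dirichlet constant is the `ℤ⁴` constant, eventually along the family**: for `0 < A < θ` there are `K₁ ≥ 0` and `β₀` with,
for `β ≥ β₀` (`H = ⌈β^θ⌉`, `T = ⌈β^A⌉`, `p_c` the box centre):
`0 ≤ C_D(p_c, p_c+Te₀) ≤ 1` and `|C_D(p_c, p_c+Te₀)² − C(T)²| ≤ K₁·β^{−4θ}`.
(`boxDirProjKernel_centre_eq`, `exists_boxDirichletPlaqCov_sub_bound`, `dirKernelTwoPoint`.) [folklore] -/
theorem abs_dirKernel_sq_sub_corr_sq_le {A θ : ℝ} (hA : 0 < A) (hAθ : A < θ) :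
    ∃ K₁ : ℝ, 0 ≤ K₁ ∧ ∃ β₀ : ℝ, ∀ β : ℝ, β₀ ≤ β →
      0 ≤ boxDirProjKernel ⌈β ^ θ⌉₊ (boxCentre ⌈β ^ θ⌉₊, 1, 2) (boxCentre ⌈β ^ θ⌉₊ + Pi.single 0 (⌈β ^ A⌉₊ : ℤ), 1, 2) ∧
      boxDirProjKernel ⌈β ^ θ⌉₊ (boxCentre ⌈β ^ θ⌉₊, 1, 2) (boxCentre ⌈β ^ θ⌉₊ + Pi.single 0 (⌈β ^ A⌉₊ : ℤ), 1, 2) ≤ 1 ∧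
      |boxDirProjKernel ⌈β ^ θ⌉₊ (boxCentre ⌈β ^ θ⌉₊, 1, 2) (boxCentre ⌈β ^ θ⌉₊ + Pi.single 0 (⌈β ^ A⌉₊ : ℤ), 1, 2) ^ 2 -
          curvaturePlaquetteCorr (d := 4) (by norm_num) (⌈β ^ A⌉₊ : ℤ) ^ 2| ≤ K₁ * β ^ (-(4 * θ)) := by
  obtain ⟨K, hK0, hK⟩ := exists_boxDirichletPlaqCov_sub_bound
  obtain ⟨κd, hκd, βd, hd⟩ := dirKernelTwoPoint hA hAθ
  have hθ : 0 < θ := hA.trans hAθ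
  have hθA : 0 < θ - A := by linarith
  -- eventually `β^θ ≥ 32` and `β^{θ−A} ≥ 16`
  have ev1 : ∀ᶠ β : ℝ in atTop, (32 : ℝ) ≤ β ^ θ := (tendsto_rpow_atTop hθ).eventually_ge_atTop 32
  have ev2 : ∀ᶠ β : ℝ in atTop, (16 : ℝ) ≤ β ^ (θ - A) := (tendsto_rpow_atTop hθA).eventually_ge_atTop 16
  obtain ⟨β₅, hβ₅⟩ := Filter.eventually_atTop.1 (ev1.and ev2)
  refine ⟨K * (2 + K), by positivity, max (max βd β₅) 1, fun β hβ => ?_⟩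
  simp only [max_le_iff] at hβ
  obtain ⟨⟨hbd, hb5⟩, hb1⟩ := hβ
  have hβ0 : 0 < β := by linarith
  obtain ⟨h32, h16⟩ := hβ₅ β hb5
  obtain ⟨hlow, hle1⟩ := hd β hbd
  set H : ℕ := ⌈β ^ θ⌉₊ with hH
  set T : ℕ := ⌈β ^ A⌉₊ with hT
  have hCD0 : 0 ≤ boxDirProjKernel H (boxCentre H, 1, 2) (boxCentre H + Pi.single 0 (T : ℤ), 1, 2) :=
    le_trans (by positivity) hlow
  -- sizes
  have hθpos : 0 < β ^ θ := Real.rpow_pos_of_pos hβ0 θ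
  have hHge : β ^ θ ≤ (H : ℝ) := Nat.le_ceil _
  have hHpos : (0 : ℝ) < H := lt_of_lt_of_le hθpos hHge
  have hH32 : (32 : ℝ) ≤ H := h32.trans hHge
  have hT2 : (T : ℝ) ≤ 2 * β ^ A := (one_le_ceil_rpow_and_le hb1 hA.le).2
  have hTH : (T : ℝ) ≤ (H : ℝ) / 8 := by
    have hsplit : β ^ θ = β ^ (θ - A) * β ^ A := by rw [← Real.rpow_add hβ0]; ring_nf
    have hApos : 0 < β ^ A := Real.rpow_pos_of_pos hβ0 A
    have h1 : 16 * β ^ A ≤ β ^ θ := by rw [hsplit]; exact mul_le_mul_of_nonneg_right h16 hApos.le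
    linarith
  -- the kernel comparison
  have hcmp := hK H hH32 T hTH
  rw [← boxDirProjKernel_centre_eq H T] at hcmp
  set CD : ℝ := boxDirProjKernel H (boxCentre H, 1, 2) (boxCentre H + Pi.single 0 (T : ℤ), 1, 2) with hCDdef
  set C : ℝ := curvaturePlaquetteCorr (d := 4) (by norm_num) (T : ℤ) with hCdef
  have hH4 : K / (H : ℝ) ^ 4 ≤ K * β ^ (-(4 * θ)) := by
    have h1 : (β ^ θ) ^ 4 ≤ (H : ℝ) ^ 4 := pow_le_pow_left₀ hθpos.le hHge 4
    have e4 : (β ^ θ) ^ 4 = β ^ (4 * θ) := by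
      rw [← Real.rpow_natCast (β ^ θ) 4, ← Real.rpow_mul hβ0.le]; norm_num; ring_nf
    have hpos4 : 0 < β ^ (4 * θ) := Real.rpow_pos_of_pos hβ0 _
    rw [e4] at h1
    rw [Real.rpow_neg hβ0.le, div_eq_mul_inv]
    exact mul_le_mul_of_nonneg_left ((inv_le_inv₀ (by positivity) hpos4).2 h1) hK0
  have hH1 : K / (H : ℝ) ^ 4 ≤ K := by
    have h1 : (1 : ℝ) ≤ (H : ℝ) ^ 4 := one_le_pow₀ (by linarith)
    exact div_le_self hK0 h1
  have hdiff : |CD - C| ≤ K * β ^ (-(4 * θ)) := hcmp.trans hH4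
  have hsumb : |CD + C| ≤ 2 + K := by
    have h1 : |C| ≤ |CD| + |CD - C| := by
      have e : C = CD - (CD - C) := by ring
      calc |C| = |CD - (CD - C)| := by rw [← e]
        _ ≤ |CD| + |CD - C| := abs_sub _ _
    have h2 : |CD| ≤ 1 := by rw [abs_of_nonneg hCD0]; exact hle1
    calc |CD + C| ≤ |CD| + |C| := abs_add_le _ _
      _ ≤ 1 + (1 + K) := by linarith [hcmp.trans hH1]
      _ = 2 + K := by ring
  refine ⟨hCD0, hle1, ?_⟩
  have e : CD ^ 2 - C ^ 2 = (CD - C) * (CD + C) := by ring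
  rw [e, abs_mul]
  have hKβ : 0 ≤ K * β ^ (-(4 * θ)) := mul_nonneg hK0 (Real.rpow_nonneg hβ0.le _)
  calc |CD - C| * |CD + C| ≤ K * β ^ (-(4 * θ)) * (2 + K) :=
        mul_le_mul hdiff hsumb (abs_nonneg _) hKβ
    _ = K * (2 + K) * β ^ (-(4 * θ)) := by ring

/-- **The two-sided free-gluon law at separation `⌈β^A⌉`, eventually, every compact `G`** — the summand of the crux
`EntropyBudgetTransfer` at `n = ⌈β^A⌉`: with the hypotheses of `twoSidedLaw_eventually_of_kernel_bounds` whose kernel-side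
constant is `σ·C_D(p_c, p_c+⌈β^A⌉e₀)²` (`0 ≤ σ`, `0 < A < θ`, window `2δ < κ₂`),
`∃ κ'' > 0, ∃ β₀, ∀ β ≥ β₀, ∀ᶠ L, |β²·torusPlaqCov ρ β L ⌈β^A⌉ 1 2 − σ·C(⌈β^A⌉)²| ≤ β^{−κ''}`.
[cite: Georgii2011, Thm. 4.17] -/
theorem twoSidedLaw_eventually_freeGluon [SecondCountableTopology G] (ρ : G →* Matrix (Fin N) (Fin N) ℂ)
    (hρ : Continuous ρ) (hρu : ∀ g, ρ g ∈ Matrix.unitaryGroup (Fin N) ℂ)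
    {A θ δ κ₂ CM B₀ σ : ℝ} (hA : 0 < A) (hAθ : A < θ) (hδ : 0 < δ) (hwin : 2 * δ < κ₂) (hσ : 0 ≤ σ)
    (m m' : ℝ → LGConfig 4 G → ℝ) (hmm : ∀ β, Measurable (m β)) (hm'm : ∀ β, Measurable (m' β))
    (hm0 : ∀ β ω, 0 ≤ m β ω) (hmM : ∀ β ω, m β ω ≤ CM * β ^ (2 * δ))
    (hm0' : ∀ β ω, 0 ≤ m' β ω) (hmM' : ∀ β ω, m' β ω ≤ CM * β ^ (2 * δ))
    (b b' C₁ : ℝ → ℝ) (hb : ∀ β, |b β| ≤ B₀) (hb' : ∀ β, |b' β| ≤ B₀)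
    (hC₁ : ∀ β, 0 ≤ C₁ β) (hC₁' : ∀ β, C₁ β ≤ 1)
    (hrar : PlaquetteLargeFieldRarityG ρ δ)
    (hcov : ∃ β₁ : ℝ, ∀ β : ℝ, β₁ ≤ β → ∀ ω : LGConfig 4 G, CrudeGoodG ρ β δ ⌈β ^ θ⌉₊ ω →
      |β ^ 2 * ((∫ U, plaqCostAt ρ (boxCentre ⌈β ^ θ⌉₊) 1 2 U *
                plaqCostAt ρ (boxCentre ⌈β ^ θ⌉₊ + Pi.single 0 (⌈β ^ A⌉₊ : ℤ)) 1 2 U ∂(boxKernelG ρ β ⌈β ^ θ⌉₊ ω)) -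
            (∫ U, plaqCostAt ρ (boxCentre ⌈β ^ θ⌉₊) 1 2 U ∂(boxKernelG ρ β ⌈β ^ θ⌉₊ ω)) *
              (∫ U, plaqCostAt ρ (boxCentre ⌈β ^ θ⌉₊ + Pi.single 0 (⌈β ^ A⌉₊ : ℤ)) 1 2 U
                ∂(boxKernelG ρ β ⌈β ^ θ⌉₊ ω))) -
          σ * boxDirProjKernel ⌈β ^ θ⌉₊ (boxCentre ⌈β ^ θ⌉₊, 1, 2)
              (boxCentre ⌈β ^ θ⌉₊ + Pi.single 0 (⌈β ^ A⌉₊ : ℤ), 1, 2) ^ 2|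
        ≤ β ^ (-(θ / 2)) + C₁ β * (m β ω + m' β ω))
    (hmean : ∃ β₂ : ℝ, ∀ β : ℝ, β₂ ≤ β → ∀ ω : LGConfig 4 G, CrudeGoodG ρ β δ ⌈β ^ θ⌉₊ ω →
      |β * (∫ U, plaqCostAt ρ (boxCentre ⌈β ^ θ⌉₊) 1 2 U ∂(boxKernelG ρ β ⌈β ^ θ⌉₊ ω)) - b β - m β ω| ≤ β ^ (-θ) ∧
        |β * (∫ U, plaqCostAt ρ (boxCentre ⌈β ^ θ⌉₊ + Pi.single 0 (⌈β ^ A⌉₊ : ℤ)) 1 2 U ∂(boxKernelG ρ β ⌈β ^ θ⌉₊ ω)) -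
            b' β - m' β ω| ≤ β ^ (-θ))
    (htb : ∃ β₃ : ℝ, ∀ β : ℝ, β₃ ≤ β → ∀ᶠ L : ℕ in atTop,
      (∫ U, m β (torusLift (L + 1) U) ∂(wilsonMeasure (d := 4) (L := L + 1) ρ β)) ≤ β ^ (-κ₂) ∧
        (∫ U, m' β (torusLift (L + 1) U) ∂(wilsonMeasure (d := 4) (L := L + 1) ρ β)) ≤ β ^ (-κ₂)) :
    ∃ κ'' : ℝ, 0 < κ'' ∧ ∃ β₀ : ℝ, ∀ β : ℝ, β₀ ≤ β → ∀ᶠ L : ℕ in atTop,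
      |β ^ 2 * torusPlaqCov (d := 4) ρ β L ⌈β ^ A⌉₊ 1 2 -
          σ * curvaturePlaquetteCorr (d := 4) (by norm_num) (⌈β ^ A⌉₊ : ℤ) ^ 2| ≤ β ^ (-κ'') := by
  have hθ : 0 < θ := hA.trans hAθ
  obtain ⟨K₁, hK₁, βK, hK⟩ := abs_dirKernel_sq_sub_corr_sq_le hA hAθ
  obtain ⟨β₁, hcov⟩ := hcov
  -- the clipped kernel-side constant, bounded by `σ` for every `β` and equal to `σ·C_D²` for `β ≥ βK`
  set CD : ℝ → ℝ := fun β =>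
    boxDirProjKernel ⌈β ^ θ⌉₊ (boxCentre ⌈β ^ θ⌉₊, 1, 2) (boxCentre ⌈β ^ θ⌉₊ + Pi.single 0 (⌈β ^ A⌉₊ : ℤ), 1, 2) with hCD
  set Φ : ℝ → ℝ := fun β => σ * (min 1 |CD β|) ^ 2 with hΦ
  have hB₀ : 0 ≤ B₀ := (abs_nonneg _).trans (hb 0)
  have hclip : ∀ x : ℝ, (min 1 |x|) ^ 2 ≤ 1 := fun x => by
    have h0 : 0 ≤ min 1 |x| := le_min zero_le_one (abs_nonneg x)
    have h1 : min 1 |x| ≤ 1 := min_le_left _ _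
    nlinarith
  have hΦB : ∀ β, |Φ β| ≤ max B₀ σ := fun β => by
    have h0 : 0 ≤ σ * (min 1 |CD β|) ^ 2 := mul_nonneg hσ (sq_nonneg _)
    rw [hΦ]; dsimp only
    rw [abs_of_nonneg h0]
    exact le_trans (by nlinarith [hclip (CD β)]) (le_max_right B₀ σ)
  have hΦeq : ∀ β, βK ≤ β → Φ β = σ * CD β ^ 2 := fun β hβ => by
    obtain ⟨h0, h1, -⟩ := hK β hβ
    rw [hΦ]; dsimp only
    rw [abs_of_nonneg h0, min_eq_right h1]
  -- the abstract family theorem with the clipped constant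
  have hcov' : ∃ β₁' : ℝ, ∀ β : ℝ, β₁' ≤ β → ∀ ω : LGConfig 4 G, CrudeGoodG ρ β δ ⌈β ^ θ⌉₊ ω →
      |β ^ 2 * ((∫ U, plaqCostAt ρ (boxCentre ⌈β ^ θ⌉₊) 1 2 U *
                plaqCostAt ρ (boxCentre ⌈β ^ θ⌉₊ + Pi.single 0 (⌈β ^ A⌉₊ : ℤ)) 1 2 U ∂(boxKernelG ρ β ⌈β ^ θ⌉₊ ω)) -
            (∫ U, plaqCostAt ρ (boxCentre ⌈β ^ θ⌉₊) 1 2 U ∂(boxKernelG ρ β ⌈β ^ θ⌉₊ ω)) *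
              (∫ U, plaqCostAt ρ (boxCentre ⌈β ^ θ⌉₊ + Pi.single 0 (⌈β ^ A⌉₊ : ℤ)) 1 2 U
                ∂(boxKernelG ρ β ⌈β ^ θ⌉₊ ω))) - Φ β|
        ≤ β ^ (-(θ / 2)) + C₁ β * (m β ω + m' β ω) := by
    refine ⟨max β₁ βK, fun β hβ ω hω => ?_⟩
    rw [hΦeq β ((le_max_right _ _).trans hβ)]
    exact hcov β ((le_max_left _ _).trans hβ) ω hω
  obtain ⟨κ', hκ', β₆, hmain⟩ := twoSidedLaw_eventually_of_kernel_bounds ρ hρ hρu (A := A) hθ hδ hwin m m' hmm hm'm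
    hm0 hmM hm0' hmM' Φ b b' C₁ hΦB (fun β => (hb β).trans (le_max_left _ _))
    (fun β => (hb' β).trans (le_max_left _ _)) hC₁ hC₁' hrar hcov' hmean htb
  -- the exponent and the two asymptotic thresholds
  set κ'' : ℝ := min κ' (4 * θ) / 2 with hκ''
  have hκ''pos : 0 < κ'' := by rw [hκ'']; exact div_pos (lt_min hκ' (by linarith)) two_pos
  have hk1 : κ'' - κ' < 0 := by
    have : min κ' (4 * θ) ≤ κ' := min_le_left _ _
    rw [hκ'']; linarith
  have hk2 : κ'' - 4 * θ < 0 := by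
    have : min κ' (4 * θ) ≤ 4 * θ := min_le_right _ _
    rw [hκ'']; linarith [hκ']
  have ev1 : ∀ᶠ β : ℝ in atTop, β ^ (κ'' - κ') < 1 / 2 := by
    have ht : Tendsto (fun β : ℝ => β ^ (κ'' - κ')) atTop (𝓝 0) := by
      have := tendsto_rpow_neg_atTop (show 0 < κ' - κ'' by linarith)
      refine this.congr' (Eventually.of_forall fun β => ?_); congr 1; ring
    exact ht.eventually (gt_mem_nhds (by norm_num))
  have ev2 : ∀ᶠ β : ℝ in atTop, σ * K₁ * β ^ (κ'' - 4 * θ) < 1 / 2 := by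
    have ht : Tendsto (fun β : ℝ => σ * K₁ * β ^ (κ'' - 4 * θ)) atTop (𝓝 (σ * K₁ * 0)) := by
      have := tendsto_rpow_neg_atTop (show 0 < 4 * θ - κ'' by linarith)
      refine (this.congr' (Eventually.of_forall fun β => ?_)).const_mul (σ * K₁); congr 1; ring
    rw [mul_zero] at ht
    exact ht.eventually (gt_mem_nhds (by norm_num))
  obtain ⟨β₇, hβ₇⟩ := Filter.eventually_atTop.1 (ev1.and ev2)
  refine ⟨κ'', hκ''pos, max (max β₆ βK) (max β₇ 1), fun β hβ => ?_⟩
  simp only [max_le_iff] at hβ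
  obtain ⟨⟨hb6, hbK⟩, hb7, hb1⟩ := hβ
  have hβ0 : 0 < β := by linarith
  obtain ⟨hA1, hA2⟩ := hβ₇ β hb7
  obtain ⟨-, -, hcmp⟩ := hK β hbK
  filter_upwards [hmain β hb6] with L hL
  rw [hΦeq β hbK] at hL
  -- `|x − σC²| ≤ |x − σC_D²| + σ|C_D² − C²|`
  have hk0 : 0 < β ^ (-κ'') := Real.rpow_pos_of_pos hβ0 _
  have h1 : β ^ (-κ') ≤ 1 / 2 * β ^ (-κ'') := by
    have e : β ^ (-κ') = β ^ (κ'' - κ') * β ^ (-κ'') := by rw [← Real.rpow_add hβ0]; ring_nf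
    rw [e]; exact mul_le_mul_of_nonneg_right hA1.le hk0.le
  have h2 : σ * (K₁ * β ^ (-(4 * θ))) ≤ 1 / 2 * β ^ (-κ'') := by
    have e : σ * (K₁ * β ^ (-(4 * θ))) = σ * K₁ * β ^ (κ'' - 4 * θ) * β ^ (-κ'') := by
      rw [mul_assoc (σ * K₁), ← Real.rpow_add hβ0]; ring_nf
    rw [e]; exact mul_le_mul_of_nonneg_right hA2.le hk0.le
  have h3 : |σ * CD β ^ 2 - σ * curvaturePlaquetteCorr (d := 4) (by norm_num) (⌈β ^ A⌉₊ : ℤ) ^ 2| ≤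
      σ * (K₁ * β ^ (-(4 * θ))) := by
    rw [← mul_sub, abs_mul, abs_of_nonneg hσ]
    exact mul_le_mul_of_nonneg_left hcmp hσ
  calc |β ^ 2 * torusPlaqCov (d := 4) ρ β L ⌈β ^ A⌉₊ 1 2 -
          σ * curvaturePlaquetteCorr (d := 4) (by norm_num) (⌈β ^ A⌉₊ : ℤ) ^ 2|
      ≤ |β ^ 2 * torusPlaqCov (d := 4) ρ β L ⌈β ^ A⌉₊ 1 2 - σ * CD β ^ 2| +
          |σ * CD β ^ 2 - σ * curvaturePlaquetteCorr (d := 4) (by norm_num) (⌈β ^ A⌉₊ : ℤ) ^ 2| := abs_sub_le _ _ _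
    _ ≤ 1 / 2 * β ^ (-κ'') + 1 / 2 * β ^ (-κ'') := add_le_add (hL.trans h1) (h3.trans h2)
    _ = β ^ (-κ'') := by ring

end Summit.QuantumFields.YangMills.Theorems.EntropyBudgetEquipartition.TwoSidedDlr

end
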